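import Mathlib
import HarnessLib
import Summits.Parity.BatemanHorn.Theses.AlmostPrimeZeros
import Summits.Parity.BatemanHorn.Theorems.AlmostPrimeZerosHadamardBookkeeping
import Summits.Parity.BatemanHorn.Theorems.AlmostPrimeZerosNormalityFromRepulsion

/-!
# Crux `SystemMomentDeficit` (stmt-Parity-11326), line `Sketch`: the edge `SystemZeroRepulsion → K1`

The open registered stub of the line `Sketch` (idea `small-circle-jensen`) is K1
`stub_smallCircleJensen`: for every Bateman–Horn system `f` there are `r > 0`, `A ≥ 0`, `x₀` such that
for every `x ≥ x₀` some real tilt `a` makes the angular mean of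
`log⁺ ‖S_x(z) e^{−a(z−1)}/(x+1)‖` over `‖z − 1‖ = r` at most `A` (`S_x(z) = Σ_{n ≤ x} z^{s_f(n)}`).

This file places K1 below the rank-2 crux as well: **`SystemZeroRepulsion → K1`**
(`smallCircle_of_systemZeroRepulsion`).  With `P = Σ_{n≤x} X^{s_f(n)}` (`P(1) = x + 1`,
`P'(1)/P(1) = m₁(x) ∈ ℝ`) the landed Hadamard bookkeeping inequality
(`Summit.Parity.BatemanHorn.Theorems.hadamardBookkeeping_proof`:
`‖P(z)‖ ≤ ‖P(1)‖ exp(−Re[(1−z)P'(1)/P(1)] + ½‖1−z‖² T_f(x))`, `T_f(x) = Σ_ρ ‖1−ρ‖⁻²`) and the tilt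
`a = m₁(x)` give, on the circle `‖z − 1‖ = 1`, `‖S_x(z)e^{−a(z−1)}/(x+1)‖ ≤ e^{T_f(x)/2} ≤ e^{|C|/2}`
pointwise once `T_f(x) ≤ C` (`x ≥ 2`), hence the circle mean of `log⁺` is at most `|C|/2`:
K1 holds with `r = 1`, `A = |C|/2`, `x₀ = 2`.

So after this line the in-tree picture around K1 is: rank 2 (`SystemZeroRepulsion`) ⇒ K1 (here),
rank 8 (`DiscMajorantLog`) ⇒ K1 (`stub_smallCircle_of_discMajorantLog`), K1 ⇒ rank 4
(`systemMomentDeficit_of_smallCircle`); K1 itself is open for every system with `Σ deg f_i ≥ 2`.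
No number theory is used here: the Bateman–Horn hypothesis is only passed to `SystemZeroRepulsion`.
-/

noncomputable section

namespace Summit.Parity.BatemanHorn.Cruxes.SystemMomentDeficit.SmallCircle

open scoped BigOperators
open Polynomial
open Summit.Parity.BatemanHorn.Theses.AlmostPrimeZeros

/-- Real-variable bookkeeping on the circle: if `s ≤ (X+1)·exp(u + ½·1²·T)` with `T ≤ C`, `X + 1 > 0`,
then `s · exp(−u) / (X+1) ≤ exp(|C|/2)`. -/
private theorem tilted_le_exp_half_abs {s X u T C : ℝ} (hX : 0 < X + 1) (hT : T ≤ C)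
    (hs : s ≤ (X + 1) * Real.exp (u + 1 / 2 * 1 ^ 2 * T)) :
    s * Real.exp (-u) / (X + 1) ≤ Real.exp (|C| / 2) := by
  rw [div_le_iff₀ hX]
  have hTC : 1 / 2 * 1 ^ 2 * T ≤ |C| / 2 := by
    have := le_abs_self C
    nlinarith
  calc s * Real.exp (-u) ≤ (X + 1) * Real.exp (u + 1 / 2 * 1 ^ 2 * T) * Real.exp (-u) :=
        mul_le_mul_of_nonneg_right hs (Real.exp_pos _).le
    _ = (X + 1) * Real.exp (1 / 2 * 1 ^ 2 * T) := by
        rw [mul_assoc, ← Real.exp_add, show u + 1 / 2 * 1 ^ 2 * T + -u = 1 / 2 * 1 ^ 2 * T by ring]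
    _ ≤ (X + 1) * Real.exp (|C| / 2) :=
        mul_le_mul_of_nonneg_left (Real.exp_le_exp.2 hTC) hX.le
    _ = Real.exp (|C| / 2) * (X + 1) := by ring

/-- **Edge `SystemZeroRepulsion → K1`.**  If `T_f(x) = Σ_ρ ‖1−ρ‖⁻² ≤ C` for `x ≥ 2` (the rank-2 crux),
then on the circle `‖z − 1‖ = 1`, with the real tilt `a = m₁(x) = P'(1)/P(1)`, the Hadamard
bookkeeping inequality gives `‖S_x(z) e^{−a(z−1)}/(x+1)‖ ≤ e^{T_f(x)/2} ≤ e^{|C|/2}` pointwise, so the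
angular mean of `log⁺` is at most `|C|/2`: K1 with `r = 1`, `A = |C|/2`, `x₀ = 2`. -/
theorem smallCircle_of_systemZeroRepulsion :
    Summit.Parity.BatemanHorn.Theses.AlmostPrimeZeros.SystemZeroRepulsion →
    ∀ (k : ℕ) (f : Fin k → Polynomial ℤ), Literature.NumberTheory.Sieve.IsBatemanHornSystem f →
      ∃ r A : ℝ, ∃ x₀ : ℕ, 0 < r ∧ 0 ≤ A ∧ ∀ x : ℕ, x₀ ≤ x → ∃ a : ℝ,
        Real.circleAverage (fun z : ℂ => Real.posLog
          ‖(∑ n ∈ Finset.range (x + 1),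
              z ^ (∑ i, (((f i).eval (n : ℤ)).toNat.factorization.sum fun _ v => min v 2))) *
            Complex.exp (-((a : ℂ) * (z - 1))) / ((x : ℂ) + 1)‖) 1 r ≤ A := by
  intro hR k f hf
  obtain ⟨C, hC⟩ := hR k f hf
  refine ⟨1, |C| / 2, 2, one_pos, by positivity, fun x hx => ?_⟩
  set e : ℕ → ℕ := fun n => ∑ i, (((f i).eval (n : ℤ)).toNat.factorization.sum fun _ v => min v 2)
    with he
  -- the tilt `a = m₁(x) = P'(1)/P(1)`
  refine ⟨((∑ n ∈ Finset.range (x + 1), e n : ℕ) : ℝ) / ((x : ℝ) + 1), ?_⟩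
  set P : ℂ[X] := ∑ n ∈ Finset.range (x + 1), (X : ℂ[X]) ^ (e n) with hP
  have heval : ∀ z : ℂ, P.eval z = ∑ n ∈ Finset.range (x + 1), z ^ (e n) := fun z =>
    Summit.Parity.BatemanHorn.Theorems.AlmostPrimeZerosNormality.eval_sum_X_pow _ e z
  have hP1 : P.eval 1 = (x : ℂ) + 1 := by rw [heval]; simp
  have hN : ((x : ℂ) + 1) ≠ 0 := by exact_mod_cast Nat.succ_ne_zero x
  have hP1ne : P.eval 1 ≠ 0 := by rw [hP1]; exact hN
  have hder : (derivative P).eval 1 = ∑ n ∈ Finset.range (x + 1), (e n : ℂ) :=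
    Summit.Parity.BatemanHorn.Theorems.AlmostPrimeZerosNormality.derivative_eval_one_sum_X_pow _ e
  have hw : (derivative P).eval 1 / P.eval 1 =
      ((((∑ n ∈ Finset.range (x + 1), e n : ℕ) : ℝ) / ((x : ℝ) + 1) : ℝ) : ℂ) := by
    rw [hder, hP1]
    push_cast
    rfl
  have hT : (P.roots.map (fun ρ : ℂ => (‖(1 : ℂ) - ρ‖ ^ 2)⁻¹)).sum ≤ C := by
    have := hC x hx
    rw [hP, he]
    exact this
  have hx1 : (0 : ℝ) < (x : ℝ) + 1 := by positivity
  apply Real.circleAverage_mono_on_of_le_circle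
  · -- `log⁺ ‖G‖` is circle integrable for the entire function `G`
    apply MeromorphicOn.circleIntegrable_posLog_norm
    intro z _
    apply AnalyticAt.meromorphicAt
    apply Differentiable.analyticAt
    fun_prop
  · intro z hz
    rw [Metric.mem_sphere, dist_eq_norm, abs_one] at hz
    have hmaj := Summit.Parity.BatemanHorn.Theorems.hadamardBookkeeping_proof P hP1ne z
    rw [hw, heval z, hP1, norm_sub_rev, hz] at hmaj
    have hNn : ‖(x : ℂ) + 1‖ = (x : ℝ) + 1 := by exact_mod_cast Complex.norm_natCast (x + 1)
    rw [hNn] at hmaj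
    rw [norm_div, norm_mul, Complex.norm_exp, hNn]
    set a : ℝ := ((∑ n ∈ Finset.range (x + 1), e n : ℕ) : ℝ) / ((x : ℝ) + 1) with ha
    have hre1 : ((1 - z) * (a : ℂ)).re = (1 - z.re) * a := by
      simp [Complex.mul_re]
    have hre2 : (-((a : ℂ) * (z - 1))).re = -((z.re - 1) * a) := by
      simp [Complex.mul_re]; ring
    rw [hre1] at hmaj
    rw [hre2]
    have hmaj' : ‖∑ n ∈ Finset.range (x + 1), z ^ (e n)‖ ≤
        ((x : ℝ) + 1) * Real.exp ((z.re - 1) * a + 1 / 2 * 1 ^ 2 *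
          (P.roots.map (fun ρ : ℂ => (‖(1 : ℂ) - ρ‖ ^ 2)⁻¹)).sum) := by
      convert hmaj using 3
      ring
    have hB := tilted_le_exp_half_abs hx1 hT hmaj'
    have hA : 0 ≤ |C| / 2 := by positivity
    calc Real.posLog (‖∑ n ∈ Finset.range (x + 1), z ^ (e n)‖ * Real.exp (-((z.re - 1) * a)) /
          ((x : ℝ) + 1))
        ≤ Real.posLog (Real.exp (|C| / 2)) := Real.posLog_le_posLog (by positivity) hB
      _ = |C| / 2 := by
          rw [Real.posLog_eq_log (by rw [abs_of_pos (Real.exp_pos _)]; exact Real.one_le_exp hA),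
            Real.log_exp]

end Summit.Parity.BatemanHorn.Cruxes.SystemMomentDeficit.SmallCircle

end
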